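import Literature.MathematicalPhysics.QuantumFieldTheory.CloverStressTensor
import Literature.MathematicalPhysics.QuantumLattice.CloverPseudoscalar
import HarnessLib

/-!
# Bridge: the clover of `CloverStressTensor` is Lüscher's clover of `LatticeWilsonFlow` / `CloverPseudoscalar`

`QuantumFieldTheory/CloverStressTensor.lean` (clover stress tensor of Caracciolo–Curci–Menotti–Pelissetto) introduces the
group-level clover leaves `cloverLeaf U x μ ν q` (closed loops in `G` based at `x`), their representation sum
`cloverSum ρ U x μ ν` and the skew-Hermitian clover field strength `cloverFieldStrength ρ U x μ ν = ⅛(Q − Qᴴ)`.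
The tree already had Lüscher's matrix-level clover `cloverLeafSum V x μ ν` (`V` a matrix link field, reversed links
through `ᴴ`; `QuantumLattice/CloverPseudoscalar.lean`) and the Lie-projected flowed clover
`flowedClover ρ t U x μ ν = π_𝔤(¼ Q_{μν}(V_t))` (`QuantumLattice/LatticeWilsonFlow.lean`).  This file proves that the
two presentations agree for unitary-valued `ρ`:

* `cloverSum_eq_cloverLeafSum` : `cloverSum ρ U x μ ν = cloverLeafSum (ρ ∘ U) x μ ν`;
* `lieProjection_cloverFieldStrength` : `π_𝔤(cloverFieldStrength ρ U x μ ν) = flowedClover ρ 0 U x μ ν` — the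
  Lie-algebra projection of the CCMP clover field strength IS Lüscher's clover field tensor at flow time `0`
  (the Hermitian part `Q + Qᴴ` is orthogonal to `𝔤 ⊆ 𝔲(N)`).

So consumers needing the clover as a Schwinger–Dyson DIRECTION (an element of `𝔤 = matrixLieAlgebra (range ρ)`)
should use `flowedClover ρ 0`, and the stress density of `CloverStressTensor` is a function of the same loops.
References: M. Lüscher, JHEP 08 (2010) 071, §3.2 Fig. 1 [Luscher2010]; S. Caracciolo, G. Curci, P. Menotti,
A. Pelissetto, Ann. Phys. 197 (1990) 119, §2 [CaraccioloEtAl1990].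
-/

noncomputable section

open scoped Matrix Matrix.Norms.Frobenius
open Literature.Probability Literature.MathematicalPhysics.QuantumLattice

namespace Literature.MathematicalPhysics.QuantumFieldTheory


variable {d N : ℕ} {G : Type*} [Group G] (ρ : G →* Matrix (Fin N) (Fin N) ℂ)

/-- Leaf `1` unwound: `U(x,ν) U(x−μ+ν,μ)⁻¹ U(x−μ,ν)⁻¹ U(x−μ,μ)`. [cite: MontvayMunster1994, (5.136)] -/
theorem cloverLeaf_one (U : LGConfig d G) (x : LatticeModels.Site d) (μ ν : Fin d) :
    cloverLeaf U x μ ν 1 =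
      U (x, ν) * (U (x - Pi.single μ 1 + Pi.single ν 1, μ))⁻¹ * (U (x - Pi.single μ 1, ν))⁻¹ *
        U (x - Pi.single μ 1, μ) := by
  simp only [cloverLeaf, Matrix.cons_val_one, Matrix.cons_val_zero, plaquetteHolonomyZd, sub_add_cancel, mul_inv_rev]
  group

/-- Leaf `2` unwound: `U(x−μ,μ)⁻¹ U(x−μ−ν,ν)⁻¹ U(x−μ−ν,μ) U(x−ν,ν)`. [cite: MontvayMunster1994, (5.136)] -/
theorem cloverLeaf_two (U : LGConfig d G) (x : LatticeModels.Site d) (μ ν : Fin d) :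
    cloverLeaf U x μ ν 2 =
      (U (x - Pi.single μ 1, μ))⁻¹ * (U (x - Pi.single μ 1 - Pi.single ν 1, ν))⁻¹ *
        U (x - Pi.single μ 1 - Pi.single ν 1, μ) * U (x - Pi.single ν 1, ν) := by
  have e1 : x - Pi.single μ 1 - Pi.single ν 1 + Pi.single μ 1 = x - Pi.single ν 1 := by abel
  simp only [cloverLeaf, Matrix.cons_val, plaquetteHolonomyZd, e1, sub_add_cancel, mul_inv_rev]
  group

/-- Leaf `3` unwound: `U(x−ν,ν)⁻¹ U(x−ν,μ) U(x−ν+μ,ν) U(x,μ)⁻¹`. [cite: MontvayMunster1994, (5.136)] -/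
theorem cloverLeaf_three (U : LGConfig d G) (x : LatticeModels.Site d) (μ ν : Fin d) :
    cloverLeaf U x μ ν 3 =
      (U (x - Pi.single ν 1, ν))⁻¹ * U (x - Pi.single ν 1, μ) * U (x - Pi.single ν 1 + Pi.single μ 1, ν) *
        (U (x, μ))⁻¹ := by
  simp only [cloverLeaf, Matrix.cons_val, plaquetteHolonomyZd, sub_add_cancel, mul_inv_rev]
  group

/-- **The two clovers agree**: for a unitary-valued `ρ`, the representation sum of the group-level leaves is
Lüscher's matrix-level clover sum of the link matrices `ρ(U_e)` (reversed links: `ρ(u⁻¹) = ρ(u)ᴴ`).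
[cite: Luscher2010, §3.2 Fig. 1] -/
theorem cloverSum_eq_cloverLeafSum (hρu : ∀ g, ρ g ∈ Matrix.unitaryGroup (Fin N) ℂ) (U : LGConfig d G)
    (x : LatticeModels.Site d) (μ ν : Fin d) :
    cloverSum ρ U x μ ν = cloverLeafSum (fun e => ρ (U e)) x μ ν := by
  have hinv : ∀ g : G, ρ g⁻¹ = (ρ g)ᴴ := fun g => (conjTranspose_eq_map_inv hρu g).symm
  simp only [cloverSum, Fin.sum_univ_four, cloverLeaf_zero, cloverLeaf_one, cloverLeaf_two, cloverLeaf_three,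
    plaquetteHolonomyZd, map_mul, hinv, cloverLeafSum]

variable {ρ}

/-- A complex-rational scalar acting on matrices is the corresponding real scalar. [folklore] -/
theorem inv_eight_smul_eq (M : Matrix (Fin N) (Fin N) ℂ) : (8 : ℂ)⁻¹ • M = ((8 : ℝ)⁻¹ : ℝ) • M := by
  rw [← Complex.coe_smul]
  norm_num

/-- **The Lie projection of the CCMP clover field strength is Lüscher's clover field tensor at flow time `0`**:
`π_𝔤(⅛(Q − Qᴴ)) = π_𝔤(¼ Q)` because `π_𝔤(Qᴴ) = −π_𝔤(Q)` for `𝔤 ⊆ 𝔲(N)`. [cite: Luscher2010, §3.2 Fig. 1] -/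
theorem lieProjection_cloverFieldStrength (hρu : ∀ g, ρ g ∈ Matrix.unitaryGroup (Fin N) ℂ) (U : LGConfig d G)
    (x : LatticeModels.Site d) (μ ν : Fin d) :
    lieProjection (Set.range ρ) (cloverFieldStrength ρ U x μ ν) = flowedClover ρ 0 U x μ ν := by
  rw [flowedClover_zero, ← cloverSum_eq_cloverLeafSum ρ hρu, cloverFieldStrength, inv_eight_smul_eq, map_smul,
    map_sub, lieProjection_conjTranspose (range_subset_unitaryGroup ρ hρu), sub_neg_eq_add, ← two_smul ℝ,
    smul_smul, map_smul]
  norm_num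

end Literature.MathematicalPhysics.QuantumFieldTheory

end
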